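import Literature.NumberTheory.EllipticCurves.ZpExtension
import Literature.NumberTheory.EllipticCurves.GeomPointsGaloisModule
import Literature.NumberTheory.GaloisRepresentations.LocalKroneckerWeberInertiaProofs
import HarnessLib

/-!
# A restricted `ℤ_p`-tower of a cyclotomic `ℤ_p`-extension is cyclotomic (T-E3g-BUDn, seam (K2))

Cell `b2b-bsdres`, team n1011, seat p10 GEN 4, row T-E3g-BUDn (ROUTE-2 II.17, Option B).  Row
T-E3g-BUDn-K (p01) constructs, for a `ℤ_p`-extension `κ` of `K` and a layer `L = K_n`, the
RESTRICTED tower `κ_L : Γ_L ↠ ℤ_p` with `p^n · κ_L(σ) = κ(σ|_K)`.  This file records that any such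
`κ_L` is the cyclotomic `ℤ_p`-extension of `L` when `κ` is the cyclotomic one of `K`
(`ZpExtension.IsCyclotomic`: `ker = χ_p⁻¹(μ(ℤ_p))`), because the `p`-adic cyclotomic character is
compatible with restriction (`cyclotomicCharacter_absGaloisRestrict`, Serre, *Abelian ℓ-adic
representations*, I §1.2) and `ℤ_p` has no `p^n`-torsion.  Needed verbatim by the level-`0` socket
over `L` (`exists_finset_layerZero_of_tamagawaWitnesses`, hypothesis `κ.IsCyclotomic`).
-/

set_option autoImplicit false

noncomputable section

open Field Literature.NumberTheory.EllipticCurves Literature.NumberTheory.GaloisRepresentations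

universe u

namespace Summit.BirchSwinnertonDyer.Rank1Residual.Additive

variable {K : Type u} [Field K] {p : ℕ} [hp : Fact p.Prime]

/-- The kernel of a restricted tower: if `p^n · κ_L(σ) = κ(σ|_K)` for all `σ ∈ Γ_L`, then
`σ ∈ ker κ_L ↔ σ|_K ∈ ker κ` (`ℤ_p` is a domain). [folklore] -/
theorem mem_kerSubgroup_restrictTower_iff (κ : ZpExtension K p) (L : Type u) [Field L] [Algebra K L]
    (κL : ZpExtension L p) (n : ℕ)
    (hκL : ∀ σ : absoluteGaloisGroup L,
      (κL σ).toAdd * (p : ℤ_[p]) ^ n = (κ (resGal (K := K) L σ)).toAdd)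
    (σ : absoluteGaloisGroup L) :
    σ ∈ κL.kerSubgroup ↔ resGal (K := K) L σ ∈ κ.kerSubgroup := by
  have hpn : (p : ℤ_[p]) ^ n ≠ 0 := pow_ne_zero _ (Nat.cast_ne_zero.mpr hp.out.ne_zero)
  rw [ZpExtension.mem_kerSubgroup, ZpExtension.mem_kerSubgroup,
    ← Multiplicative.toAdd.apply_eq_iff_eq (y := (1 : Multiplicative ℤ_[p])),
    ← Multiplicative.toAdd.apply_eq_iff_eq (y := (1 : Multiplicative ℤ_[p])), toAdd_one,
    ← hκL σ, mul_eq_zero]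
  exact ⟨fun h ↦ Or.inl h, fun h ↦ h.resolve_right hpn⟩

/-- **A restricted tower of the cyclotomic `ℤ_p`-extension is cyclotomic.** If `κ` is the cyclotomic
`ℤ_p`-extension of the number field `K` and `κ_L : Γ_L ↠ ℤ_p` satisfies `p^n · κ_L(σ) = κ(σ|_K)`
(the tower `K_∞ L / L`, e.g. `L = K_n`), then `κ_L` is the cyclotomic `ℤ_p`-extension of `L`:
`ker κ_L = (σ|_K)⁻¹(ker κ) = (σ|_K)⁻¹ χ_{p,K}⁻¹(μ(ℤ_p)) = χ_{p,L}⁻¹(μ(ℤ_p))` by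
`χ_{p,K}(σ|_K) = χ_{p,L}(σ)`. [cite: SerreAbelianLadic1968, Ch. I §1.2] [cite: Washington1997, §13.1] -/
theorem isCyclotomic_restrictTower [NumberField K] (κ : ZpExtension K p) (hκ : κ.IsCyclotomic)
    (L : Type u) [Field L] [Algebra K L] (κL : ZpExtension L p) (n : ℕ)
    (hκL : ∀ σ : absoluteGaloisGroup L,
      (κL σ).toAdd * (p : ℤ_[p]) ^ n = (κ (resGal (K := K) L σ)).toAdd) :
    κL.IsCyclotomic := by
  haveI : NeZero (p : K) := ⟨Nat.cast_ne_zero.mpr hp.out.ne_zero⟩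
  unfold ZpExtension.IsCyclotomic at hκ ⊢
  ext σ
  rw [mem_kerSubgroup_restrictTower_iff κ L κL n hκL σ, hκ, Subgroup.mem_comap, Subgroup.mem_comap]
  change GaloisRep.cyclotomicCharacter K p (absGaloisRestrict K L σ) ∈ _ ↔
    GaloisRep.cyclotomicCharacter L p σ ∈ _
  rw [cyclotomicCharacter_absGaloisRestrict K L p σ]

end Summit.BirchSwinnertonDyer.Rank1Residual.Additive
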